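import Summits.BirchSwinnertonDyer.BirchSwinnertonDyer.Theorems.EisensteinPrimesMazurMCOnCellBCongruenceRoad
import Summits.BirchSwinnertonDyer.BirchSwinnertonDyer.Theorems.EisensteinPrimesMazurMCOnCellBLocate
import Summits.BirchSwinnertonDyer.Rank1Residual.Partition.GreenbergVatsalIsogenyPeriodStep
import Summits.BirchSwinnertonDyer.Rank1Residual.X2.CongruenceTransfer
import Summits.BirchSwinnertonDyer.Rank1Residual.X2.IsogenyQuotientLine
import Summits.BirchSwinnertonDyer.Rank1Residual.X1.StableCyclicQuotient
import Literature.NumberTheory.EllipticCurves.KatoRankBoundProofs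
import Literature.NumberTheory.EllipticCurves.IwasawaSelmerDualProofs
import Literature.NumberTheory.EllipticCurves.IwasawaSelmerModuleFiniteProofs
import HarnessLib

/-!
# Crux `MazurMCOnCellB` (stmt-BirchSwinnertonDyer-19033), line `mudescent`, stub
# `stub_analyticMuZero_offLocus`: the congruence road — NEGATIVE LEMMA: an ISOGENY-invariant
# transfer of analytic `μ = 0` contradicts the stub on every X2b class (cell `bsd-eis`, seat
# `bsd-eis-mu-c`; sequel of `EisensteinPrimesMazurMCOnCellBCongruenceRoad.lean`; closes NO stub)

The companion file typed the congruence road as stub ⇐ (T) ∧ (S) with (T) = transfer of analytic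
`μ = 0` along `W[p] ≅ W′[p]` (`TorsionIso`; UNPRINTED at a reducible `p`: Greenberg–Vatsal Thm. (3.10)
and Emerton–Pollack–Weston Thm. 1 are irreducible, Thm. (3.12) reads the odd branch on type A). THIS
file shows, in the kernel and relative to three PUBLISHED facts taken as hypotheses (Greenberg LNM 1716
Prop. 5.7 `h57`, Wuthrich 2014 Thm. 16 `hWu`, modularity `hpar`), that (T) cannot be weakened to any
transfer principle invariant under `ℚ`-ISOGENY — in particular to any notion of «congruence» that only
reads the semisimplification `E[p]^{ss} = φ ⊕ ψ`, i.e. the Hecke eigenvalues `a_ℓ (mod p)`: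

* `lineOdd_range_of_ker_lineEven` — parity flip: an equivariant `g : E[p] → E′[p]` with EVEN kernel
  line has an ODD image line (`det ρ̄(c) = −1` via the tree's Weil-pairing signs (hc)); the parity-only
  companion of the tree's four kernel/image lemmas (`X2.IsogenyLineType`, `GVPeriod`,
  `X1.StableCyclicQuotient`, `…MazurMCOnX1RankZeroLocate` §1);
* `exists_isIsogenous_hasRamifiedOddLineAt_of_offLocus` — the étale end `W₀` (reducible, type A, off
  the locus, `p` odd of good ORDINARY or MULTIPLICATIVE reduction) has a `ℚ`-isogenous globally
  minimal neighbour `W₁ = W₀/Φ` ON the barrier locus `HasRamifiedOddLineAt` (`X₁(11) → X₀(11)` at `5`;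
  `219b` at `3`): Serre/Tate-free inertia line (`GVPeriod.exists_inertiaLine_of_goodOrd_or_mult`) +
  III.4.12 quotient + the parity flip; reduction-agnostic, so it serves crux 5 (`MazurMCOnX1RankZero`)
  verbatim;
* `not_analyticMuLE_zero_of_isogenyTransfer` — hence at `p ‖ N` an isogeny-invariant transfer makes
  `X2.AnalyticMuLE W₀ p 0` FALSE: at `W₁` it would give `μ(X(W₁/ℚ_∞)) = 0` (Kato–Wuthrich,
  `X2.isTorsion_and_mu_eq_zero_of_analyticMuLE_zero`) against `μ ≥ 1` (`EisensteinMuBarrier`);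
  `…_of_cellB` is the `X2.CellB` form, and `not_cellB_of_isogenyTransfer_of_stub` the corollary: such
  a principle AND the stub together empty row A10 (127 census cells) — via the LANDED `stub_locate`
  (p443911) and `X2.cellB_iff_of_isIsogenous` (Tate uniformisation discharged).

READING. In print the jump of `μ` along `W₀ → W₀/Φ` is exactly `+1` on both sides (Schneider 1987 /
Perrin-Riou 1989, Greenberg LNM 1716 p. 58), so the conclusion is no surprise; its value is to pin the
residue of the road: a usable (T) must depend on the EXTENSION CLASS of the non-split `W₀[p]`
(companion §2), which is what a congruence of `q`-expansions modulo an Eisenstein maximal ideal does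
not see, and what the canonical period does not control for the `+` sign on type A (it exists for
the admissible sign `−ψ(−1)` only: GV pp. 32–33 after [Vat97] Thms. 1.3 and 2.7; Rem. (3.9)).
HONEST FRAMING: nothing here proves or refutes the stub; the three facts are hypotheses exactly as in
the route's `PublishedInputs` / the barrier file. References: [GreenbergLNM1716] Prop. 5.7, Conj. 1.11,
p. 58; [Wuthrich2014] Thm. 16; [Schneider1987MuIsogenies]; [PerrinRiou1989Isogenie] Théorème p. 349;
[GreenbergVatsal2000] Thm. (3.10), (3.12), Rem. (3.9), pp. 32–33, §2 p. 28; HOME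
`run/shared/lean/pub/bsd-eis/mu-c-MEMO-1.md`.
-/

set_option autoImplicit false

-- `Summit.BirchSwinnertonDyer.BirchSwinnertonDyer.…`: the summit and its single sub-problem share a name (D-0017 layout).
set_option linter.dupNamespace false

noncomputable section

open scoped Classical

open WeierstrassCurve NumberField IsDedekindDomain Field
  Literature.NumberTheory.EllipticCurves
  Literature.NumberTheory.EllipticCurves.Rank1Residual
  Literature.NumberTheory.GaloisRepresentations
  Literature.Barriers.BirchSwinnertonDyer
  Summit.BirchSwinnertonDyer.Rank1Residual
  Summit.BirchSwinnertonDyer.Rank1Residual.X1.CongruenceTransfer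
  Summit.BirchSwinnertonDyer.BirchSwinnertonDyer.Theorems.EisensteinPrimesMazurMCOnCellBCongruenceRoad

namespace Summit.BirchSwinnertonDyer.BirchSwinnertonDyer.Theorems.EisensteinPrimesMazurMCOnCellBCongruenceRoadIsogeny

variable {W W' : WeierstrassCurve ℚ} {p : ℕ} [hp : Fact p.Prime]

/-! ## §1 Parity flip and the isogenous neighbour on the locus (reduction-agnostic) -/

/-- **Parity flip along an isogeny: an EVEN kernel line has an ODD image line.** For
`g : E[p] → E′[p]` `Γ_ℚ`-equivariant whose kernel is even and whose image is a rational line, the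
image is odd: a non-zero anti-fixed vector `Q` of complex conjugation ((hc), Weil pairing) is not in the
even kernel, and `c·g(Q) = g(cQ) = −g(Q)` (`p` odd). The sign bookkeeping `ψ(−1) = ω(−1)φ(−1)⁻¹ =
−φ(−1)` of CGS 2025 p. 2 in the kernel. [cite: CastellaGrossiSkinner2025, Introduction (p. 2)] -/
theorem lineOdd_range_of_ker_lineEven
    (g : geomTorsion W (p : ℤ) →+ geomTorsion W' (p : ℤ))
    (hg : ∀ (σ : absoluteGaloisGroup ℚ) (P : geomTorsion W (p : ℤ)), g (σ • P) = σ • g P)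
    (hp2 : p ≠ 2)
    (hc : ∀ c : absoluteGaloisGroup ℚ, IsComplexConjugation (Rat.castHom ℝ) c →
      (∃ P : geomTorsion W (p : ℤ), P ≠ 0 ∧ c • P = P) ∧
        (∃ Q : geomTorsion W (p : ℤ), Q ≠ 0 ∧ c • Q = -Q))
    (heven : LineEven W p g.ker) (hrange : IsRationalLine W' p g.range) :
    LineOdd W' p g.range := by
  rcases lineEven_or_lineOdd hrange with hev | hodd
  swap
  · exact hodd
  exfalso
  obtain ⟨c, hcc⟩ := exists_isComplexConjugation (Rat.castHom ℝ)
  obtain ⟨-, Q, hQ0, hQ⟩ := hc c hcc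
  have h1 : c • g Q = g Q := hev c hcc (g Q) ⟨Q, rfl⟩
  have h2 : g (c • Q) = -g Q := by rw [hQ, map_neg]
  rw [hg, h1] at h2
  have h3 : g Q + g Q = 0 := by
    nth_rewrite 2 [h2]
    exact add_neg_cancel _
  have h4 : g Q = 0 := eq_zero_of_add_self_eq_zero hp2 h3
  have hQker : Q ∈ g.ker := by rwa [AddMonoidHom.mem_ker]
  have h5 : c • Q = Q := heven c hcc Q hQker
  rw [h5] at hQ
  have h6 : Q + Q = 0 := by
    nth_rewrite 2 [hQ]
    exact add_neg_cancel Q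
  exact hQ0 (eq_zero_of_add_self_eq_zero hp2 h6)

/-- **The isogenous neighbour of the étale end is ON the barrier locus.** At an odd prime of good
ORDINARY or MULTIPLICATIVE reduction, a reducible type-A curve `W₀` off the locus has a `ℚ`-isogenous
globally minimal `W₁ = W₀/Φ` (`Φ` its rational `p`-line, unramified-even by the companion's
`lineUnramifiedAt_and_lineEven_of_offLocus`) carrying a rational line RAMIFIED at `p` and ODD, and `W₁`
is again good ordinary resp. multiplicative at `p` (`X₁(11) → X₀(11)` at `5`; `219b` at `3`). Kernel
theorem (Serre / Tate-free inertia line, III.4.12 quotient, parity flip).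
[cite: GreenbergLNM1716, Conj. 1.11 (p. 58) and §5 (conductor 11 at p = 5)] -/
theorem exists_isIsogenous_hasRamifiedOddLineAt_of_offLocus [W.IsElliptic] [W.IsGloballyMinimal]
    (hp2 : p ≠ 2)
    (hred' : (W.HasGoodReductionAtPrime p ∧ ¬ (p : ℤ) ∣ W.frobeniusTrace p) ∨
      W.HasMultiplicativeReductionAtPrime p)
    (hred : ¬ W.HasIrreducibleModPGaloisRep p) (hA : ¬ GVPar W p)
    (hoff : ¬ HasRamifiedOddLineAt W p) :
    ∃ (W₁ : WeierstrassCurve ℚ) (_ : W₁.IsElliptic) (_ : W₁.IsGloballyMinimal),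
      IsIsogenous W W₁ ∧ HasRamifiedOddLineAt W₁ p ∧
        ((W₁.HasGoodReductionAtPrime p ∧ ¬ (p : ℤ) ∣ W₁.frobeniusTrace p) ∨
          W₁.HasMultiplicativeReductionAtPrime p) := by
  obtain ⟨Φ, hΦ⟩ := exists_isRationalLine_of_not_irr W p hred
  obtain ⟨hu, hev⟩ := lineUnramifiedAt_and_lineEven_of_offLocus hA hoff hΦ
  obtain ⟨W₁, hW₁, hW₁min, ψ, hker, -⟩ := X2.IsogenyQuotientLine.exists_isogeny_ker_eq_line hΦ
  have hiso : IsIsogenous W W₁ := ⟨ψ⟩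
  refine ⟨W₁, hW₁, hW₁min, hiso, ?_, GVPeriod.goodOrd_or_mult_of_isIsogenous hiso hred'⟩
  obtain ⟨g, hgval, hg⟩ := X2.IsogenyLineType.exists_restrict_torsion (p := p) ψ
  have hK : g.ker = Φ := GVPeriod.ker_restrict_eq ψ hgval hker
  have hKcard : Nat.card g.ker = p := by rw [hK]; exact hΦ.1
  -- (hL₀) at one prime above `p`
  obtain ⟨v, hv⟩ :=
    Literature.NumberTheory.NumberFields.RingOfIntegers.exists_heightOneSpectrum_natCast_mem ℚ hp.out
  obtain ⟨𝔓, h𝔓⟩ := HeightOneSpectrum.primesAbove_nonempty v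
  have hL₀ : ∃ (v : HeightOneSpectrum (𝓞 ℚ)), (p : 𝓞 ℚ) ∈ v.asIdeal ∧ ∃ 𝔓 ∈ v.primesAbove,
      ∃ L : AddSubgroup (geomTorsion W (p : ℤ)), Nat.card L = p ∧
        (∀ σ ∈ 𝔓.inertia (absoluteGaloisGroup ℚ), ∀ P : geomTorsion W (p : ℤ), σ • P - P ∈ L) ∧
        (∃ σ ∈ 𝔓.inertia (absoluteGaloisGroup ℚ), ∃ P ∈ L, σ • P ≠ P) :=
    ⟨v, hv, 𝔓, h𝔓, GVPeriod.exists_inertiaLine_of_goodOrd_or_mult W p hp2 hred' v hv 𝔓 h𝔓⟩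
  obtain ⟨hrat, hram⟩ := X1.StableCyclicQuotient.isRationalLine_range_and_not_unramified_of_ker g hg
    (Rank1Residual.natCard_geomTorsion W p) hL₀ hKcard (hK ▸ hu)
  have hodd : LineOdd W₁ p g.range := lineOdd_range_of_ker_lineEven g hg hp2
    (exists_fixed_and_antifixed_of_isComplexConjugation W hp2) (hK ▸ hev) hrat
  exact ⟨g.range, hrat, hram, hodd⟩

/-! ## §2 The negative lemma at `p ‖ N` (X2 currency) -/

/-- **NEGATIVE LEMMA — an ISOGENY-invariant transfer of analytic `μ = 0` contradicts the stub at every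
off-locus X2b curve.** Relative to Greenberg's Prop. 5.7 (`h57`), Wuthrich 2014 Thm. 16 (`hWu`) and
modularity (`hpar`): IF analytic `μ = 0` passed from a multiplicative reducible pair to every
`ℚ`-ISOGENOUS curve (as it would under any congruence notion that only reads `E[p]^{ss}`, i.e. the
`a_ℓ (mod p)`), THEN `μ_an(W₀) = 0` FAILS at every reducible type-A off-locus `W₀`: transported to
`W₁ = W₀/Φ` (on the locus, §1) it would give `μ(X(W₁/ℚ_∞)) = 0` by Kato–Wuthrich, against `μ ≥ 1`
(`EisensteinMuBarrier`). In print the jump of `μ` along `W₀ → W₀/Φ` is `+1` exactly (Schneider 1987 /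
Perrin-Riou 1989). So a valid transfer (T) must see the extension class of `E[p]`, not its
semisimplification. [cite: GreenbergLNM1716, Prop. 5.7 (p. 113) and p. 58]
[cite: Wuthrich2014, Thm. 16 (p. 397)] [cite: Schneider1987MuIsogenies, Theorem]
[cite: PerrinRiou1989Isogenie, Théorème (p. 349)] -/
theorem not_analyticMuLE_zero_of_isogenyTransfer [W.IsElliptic] [W.IsGloballyMinimal]
    (h57 : Greenberg1999.prop57_one_le_mu_of_ramified_odd_line)
    (hWu : Wuthrich2014.thm16_charIdeal_dvd_multiplicative_of_reducible)
    (hpar : ModularForms.nonempty_modularParametrizationData)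
    (hTiso : ∀ (V V' : WeierstrassCurve ℚ) [V.IsElliptic] [V.IsGloballyMinimal] [V'.IsElliptic]
        [V'.IsGloballyMinimal], V.HasMultiplicativeReductionAtPrime p →
        ¬ V.HasIrreducibleModPGaloisRep p → IsIsogenous V V' →
        X2.AnalyticMuLE V p 0 → X2.AnalyticMuLE V' p 0)
    (hp2 : p ≠ 2) (hmult : W.HasMultiplicativeReductionAtPrime p)
    (hred : ¬ W.HasIrreducibleModPGaloisRep p) (hA : ¬ GVPar W p)
    (hoff : ¬ HasRamifiedOddLineAt W p) : ¬ X2.AnalyticMuLE W p 0 := by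
  intro hμ
  obtain ⟨W₁, _, _, hiso, hloc, -⟩ :=
    exists_isIsogenous_hasRamifiedOddLineAt_of_offLocus hp2 (Or.inr hmult) hred hA hoff
  have hmult₁ : W₁.HasMultiplicativeReductionAtPrime p :=
    X2.IsogenyQuotientLine.hasMultiplicativeReductionAtPrime_of_isIsogenous hiso hmult
  obtain ⟨Ψ, hΨ⟩ := hloc.exists_isRationalLine
  have hred₁ : ¬ W₁.HasIrreducibleModPGaloisRep p := not_hasIrreducibleModPGaloisRep_of_isRationalLine hΨ
  have hμ₁ : X2.AnalyticMuLE W₁ p 0 := hTiso W W₁ hmult hred hiso hμ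
  obtain ⟨κ, hκ, γ, hγ, hγ'⟩ := exists_isCyclotomic_isTopGenerator_isCyclotomicVariable_holds p
  obtain ⟨D⟩ := W₁.nonempty_selmerDualData_holds κ γ hγ
  haveI : Module.Finite (IwasawaAlgebra p) D.X := D.module_finite_holds hγ
  obtain ⟨hD, hmu⟩ :=
    X2.isTorsion_and_mu_eq_zero_of_analyticMuLE_zero hWu hpar hp2 hmult₁ hred₁ hμ₁ hκ hγ hγ' D
  exact EisensteinMuBarrier.mu_ne_zero h57 hp2 (Or.inr hmult₁) hloc hκ hγ D hD hmu

/-- **The negative lemma on the cell: an isogeny-invariant transfer makes the stub's conclusion FALSE at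
every off-locus X2b pair** (relative to Prop. 5.7, Wuthrich Thm. 16, modularity).
[cite: GreenbergLNM1716, Prop. 5.7 (p. 113)] [cite: Wuthrich2014, Thm. 16 (p. 397)] -/
theorem not_analyticMuLE_zero_of_isogenyTransfer_of_cellB [W.IsElliptic] [W.IsGloballyMinimal]
    (h57 : Greenberg1999.prop57_one_le_mu_of_ramified_odd_line)
    (hWu : Wuthrich2014.thm16_charIdeal_dvd_multiplicative_of_reducible)
    (hpar : ModularForms.nonempty_modularParametrizationData)
    (hTiso : ∀ (V V' : WeierstrassCurve ℚ) [V.IsElliptic] [V.IsGloballyMinimal] [V'.IsElliptic]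
        [V'.IsGloballyMinimal], V.HasMultiplicativeReductionAtPrime p →
        ¬ V.HasIrreducibleModPGaloisRep p → IsIsogenous V V' →
        X2.AnalyticMuLE V p 0 → X2.AnalyticMuLE V' p 0)
    (hc : X2.CellB W p) (hoff : ¬ HasRamifiedOddLineAt W p) : ¬ X2.AnalyticMuLE W p 0 :=
  not_analyticMuLE_zero_of_isogenyTransfer h57 hWu hpar hTiso hc.2.1.1 hc.2.1.2.2 hc.2.1.2.1 hc.2.2 hoff

/-- **COROLLARY — an isogeny-invariant transfer principle AND the stub empty the cell X2b.** Given
both, every X2b pair `(W, p)` descends (LANDED `stub_locate`, p443911) to an off-locus isogenous `W₀`,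
still in `X2.CellB` (`X2.cellB_iff_of_isIsogenous`, Tate uniformisation discharged), where §2 and the
stub collide. Since row A10 has 127 census cells, the reading is: the congruence road with a
semisimple / `a_ℓ`-congruence notion is DEAD; only an extension-class-sensitive (T) survives, and that
is unprinted (companion file). [cite: GreenbergLNM1716, Prop. 5.7 (p. 113) and Conj. 1.11 (p. 58)]
[cite: Wuthrich2014, Thm. 16 (p. 397)] -/
theorem not_cellB_of_isogenyTransfer_of_stub
    (h57 : Greenberg1999.prop57_one_le_mu_of_ramified_odd_line)
    (hWu : Wuthrich2014.thm16_charIdeal_dvd_multiplicative_of_reducible)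
    (hpar : ModularForms.nonempty_modularParametrizationData)
    (hTiso : ∀ (V V' : WeierstrassCurve ℚ) [V.IsElliptic] [V.IsGloballyMinimal] [V'.IsElliptic]
        [V'.IsGloballyMinimal], V.HasMultiplicativeReductionAtPrime p →
        ¬ V.HasIrreducibleModPGaloisRep p → IsIsogenous V V' →
        X2.AnalyticMuLE V p 0 → X2.AnalyticMuLE V' p 0)
    (hstub : ∀ (W₀ : WeierstrassCurve ℚ) [W₀.IsElliptic] [W₀.IsGloballyMinimal],
        X2.CellB W₀ p → ¬ HasRamifiedOddLineAt W₀ p → X2.AnalyticMuLE W₀ p 0)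
    (W : WeierstrassCurve ℚ) [W.IsElliptic] [W.IsGloballyMinimal] : ¬ X2.CellB W p := by
  intro hc
  obtain ⟨W₀, _, _, hiso, hoff⟩ := EisensteinPrimesMazurMCOnCellBLocate.stub_locate W p hc
  have hc₀ : X2.CellB W₀ p :=
    (X2.cellB_iff_of_isIsogenous (p := p) TateCurve.Silverman1994_thmV53_tateUniformisation_holds
      TateCurve.Silverman1994_thmV53_corV54_tateUniformisation_holds hiso).mp hc
  exact not_analyticMuLE_zero_of_isogenyTransfer_of_cellB h57 hWu hpar hTiso hc₀ hoff
    (hstub W₀ hc₀ hoff)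

end Summit.BirchSwinnertonDyer.BirchSwinnertonDyer.Theorems.EisensteinPrimesMazurMCOnCellBCongruenceRoadIsogeny

end
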